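import Mathlib
import Summits.AtomisticToContinuum.Crystallization.Theses.PhononSlackCertificates
import Summits.AtomisticToContinuum.Crystallization.Theorems.PhononSlackCertificatesAllBadGapFloor
import Summits.AtomisticToContinuum.Crystallization.Theorems.PhononSlackCertificatesNearFarGlueRReductionTight
import Summits.AtomisticToContinuum.Crystallization.Theorems.NearFarGlueR.Negative.GlueToolkit
import Literature.MathematicalPhysics.StatisticalMechanics.LennardJonesClusters
import Literature.Geometry.DiscreteGeometry.TwoShellPatterns

/-!
# Crux `PhononSlackCertificates.NearFarGlueR` (stmt-AtomisticToContinuum-14970), line `Sketch`: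
the near field is NOT load-bearing — the exact structure of the crux

Continuation lead c1.  The line's registered residual is the TIGHT CONTACT GAP (bad particles
within `21/20` of a good particle pay `g₂(δ) > 0` in the total energy, `stub_tightContactGap`);
`nearFarGlueR_of_tightContactGap` (ReductionTight) closes the crux from it through the lead-0 glue
`stub_glueTight`, which consumes `NearFieldConvexity`.  Here the glue is redone WITHOUT the near
field (the standing disprover's argument, `Cruxes/NearFarGlueR/Disproof.lean` §6/§9, adapted to the
landed descent `stub_descentTight` + sharp covers): the good side is handled by restriction and
periodisation (`N·e* ≤ E`, `card_mul_iInf_le_interactionEnergy`) with the cross attraction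
good ↔ bad charged to the bad side (`2A` per `R'`-boundary bad particle by the full shell sum, `g`
per `R'`-interior bad particle by the tail shell sum), the `R'`-boundary of the bad set is counted
against the tight contacts (nearest good particle + ONE descent step + fibre), and a convex
combination with the tight contact gap closes.  Consequences, all UNCONDITIONAL equivalences of
open route statements:

* `coerciveTwoShellGap_of_farFieldGapR_of_tightContactGap : FarFieldGapR → TightContactGap → CoerciveTwoShellGap`
  (= the registered stub `stub_glueNearFree` of skeleton v5, implication form below);
* (companion file `PhononSlackCertificatesNearFarGlueRStructure.lean`, with the sibling crux's
  `farFieldGapR_of_coerciveTwoShellGap` / `farFieldGapR_iff_allBadGap`):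
  `CoerciveTwoShellGap ↔ FarFieldGapR ∧ TightContactGap ↔ AllBadGap ∧ TightContactGap` — the route's
  TARGET is exactly "all-bad bulk pays" ∧ "the first contact layer next to good crystal pays";
* `nearFarGlueR_iff : NearFarGlueR ↔ (FarFieldGapR → NearFieldConvexity → TightContactGap)`:
  the crux as typed IS the statement that its two antecedents yield the tight contact gap — and
  both antecedents are silent on tight contacts (Negative/ThinSetVacuity), which is why the
  residual is crux-sized.

`TightContactGap` is written out verbatim (it is the registered stub's signature; no new definition).
-/

noncomputable section

namespace Summit.AtomisticToContinuum.Crystallization.Theorems.PhononSlackCertificatesNearFarGlueR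

open Literature.MathematicalPhysics.StatisticalMechanics
open Literature.Geometry.DiscreteGeometry
open Summit.AtomisticToContinuum.Crystallization.Theses.PhononSlackCertificates
open Summit.AtomisticToContinuum.Crystallization.Theorems.NearFarGlueRNegative
  (sum_inv_pow_six_tail_le fibre_count sum_halfSite_eq_restrict sum_halfSite_sub_eStar glue_arith
    cross_arith)
open Summit.AtomisticToContinuum.Crystallization.Theorems.PhononSlackCertificatesAllBadGapFloor
  (card_mul_iInf_le_interactionEnergy)
open scoped BigOperators RealInnerProductSpace

/-- **The near-free glue.**  `FarFieldGapR → TightContactGap → CoerciveTwoShellGap`, with NO use of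
`NearFieldConvexity`: far field on the bad set `B` (moved to the radius
`R' = max (max R (21/20)) (n₀ δ)` and the constant `max C' 0`), periodisation `#G·e* ≤ E(x|_G)` on
the good set, cross attraction charged to `B` (`2A`, `A = 125/6·δ⁻⁶`, per `R'`-boundary bad particle;
`g` per `R'`-interior one, `n₀ = ⌈(125/3)δ⁻⁶/g⌉ + 1`), `#∂_{R'}B ≤ ((2R'/δ+1)³ + 1)·#T` by the nearest
good particle, one step of `stub_descentTight` and `fibre_count`, and the convex combination
`g₂·(g/2)/(g₂ + M)`, `M = (max C' 0 + A)((2R'/δ+1)³ + 1)`. [folklore] -/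
-- adapted from Cruxes/NearFarGlueR/Disproof.lean §9 `coerciveTwoShellGap_of_far_contact_at`
-- (refuter-cdisprove-stmt-AtomisticToContinuum-14970-0), descent supplied by the landed stubs
theorem coerciveTwoShellGap_of_farFieldGapR_of_tightContactGap (hfar : FarFieldGapR)
    (hcontact : ∀ δ : ℝ, 0 < δ → ∃ g₂ : ℝ, 0 < g₂ ∧ ∀ (N : ℕ) (x : Fin N → EuclideanSpace ℝ (Fin 3)),
      (∀ i j : Fin N, i ≠ j → δ ≤ dist (x i) (x j)) →
      (N : ℝ) * (⨅ Q : PeriodicConfiguration 3, Q.energyPerParticle lennardJones)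
        + g₂ * (Nat.card {j : Fin N // ¬ IsTwoShellGood (1 / 20) (47 / 50) 1 x j ∧
            ∃ i : Fin N, IsTwoShellGood (1 / 20) (47 / 50) 1 x i ∧ dist (x i) (x j) ≤ 21 / 20} : ℝ)
        ≤ interactionEnergy lennardJones x) :
    CoerciveTwoShellGap := by
  have hdesc := stub_descentTight stub_coverFccSharp stub_coverHcpSharp
  intro δ hδ
  obtain ⟨g, hg, C', R, hAt⟩ := hfar δ hδ
  obtain ⟨g₂, hg₂, hCG⟩ := hcontact δ hδ
  -- constants (all chosen from `δ, g, C', R, g₂` only)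
  obtain ⟨A, hA⟩ : ∃ A : ℝ, A = (125 / 6 : ℝ) * δ⁻¹ ^ 6 := ⟨_, rfl⟩
  obtain ⟨n₀, hn₀⟩ : ∃ n₀ : ℕ, n₀ = ⌈(125 / 3 : ℝ) * δ⁻¹ ^ 6 / g⌉₊ + 1 := ⟨_, rfl⟩
  obtain ⟨R', hR'⟩ : ∃ R' : ℝ, R' = max (max R (21 / 20)) ((n₀ : ℝ) * δ) := ⟨_, rfl⟩
  obtain ⟨C'', hC''⟩ : ∃ C'' : ℝ, C'' = max C' 0 := ⟨_, rfl⟩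
  obtain ⟨K', hK'⟩ : ∃ K' : ℝ, K' = (2 * R' / δ + 1) ^ 3 + 1 := ⟨_, rfl⟩
  obtain ⟨M, hM⟩ : ∃ M : ℝ, M = (C'' + A) * K' := ⟨_, rfl⟩
  have hA0 : 0 ≤ A := by rw [hA]; positivity
  have hn₀1 : 1 ≤ n₀ := by rw [hn₀]; exact Nat.le_add_left 1 _
  have hn₀pos : (0 : ℝ) < n₀ := by exact_mod_cast hn₀1
  have hn₀ge : (125 / 3 : ℝ) * δ⁻¹ ^ 6 / g ≤ n₀ := by
    have h1 := Nat.le_ceil ((125 / 3 : ℝ) * δ⁻¹ ^ 6 / g)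
    have h2 : (⌈(125 / 3 : ℝ) * δ⁻¹ ^ 6 / g⌉₊ : ℝ) ≤ n₀ := by
      rw [hn₀]; push_cast; linarith
    exact h1.trans h2
  have htailg : (125 / 3 : ℝ) * δ⁻¹ ^ 6 / n₀ ≤ g := by
    rw [div_le_iff₀ hn₀pos]
    have := (div_le_iff₀ hg).1 hn₀ge
    linarith
  have hR'R : R ≤ R' := by rw [hR']; exact (le_max_left _ _).trans (le_max_left _ _)
  have hR'3 : (21 / 20 : ℝ) ≤ R' := by rw [hR']; exact (le_max_right _ _).trans (le_max_left _ _)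
  have hR'n : (n₀ : ℝ) * δ ≤ R' := by rw [hR']; exact le_max_right _ _
  have hR'0 : (0 : ℝ) ≤ R' := by linarith
  have hC''0 : 0 ≤ C'' := by rw [hC'']; exact le_max_right _ _
  have hC''C : C' ≤ C'' := by rw [hC'']; exact le_max_left _ _
  have hK'pos : 0 ≤ (2 * R' / δ + 1) ^ 3 := by positivity
  have hK'1 : 1 ≤ K' := by rw [hK']; linarith
  have hM0 : 0 ≤ M := by rw [hM]; exact mul_nonneg (by linarith) (by linarith)
  refine ⟨g₂ * (g / 2) / (g₂ + M), by positivity, fun N x hsep => ?_⟩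
  classical
  -- the cast of characters (opaque names with defining equations)
  obtain ⟨B, hB⟩ : ∃ B : Finset (Fin N),
      B = Finset.univ.filter (fun i : Fin N => ¬ IsTwoShellGood (1 / 20) (47 / 50) 1 x i) := ⟨_, rfl⟩
  obtain ⟨G, hG⟩ : ∃ G : Finset (Fin N),
      G = Finset.univ.filter (fun i : Fin N => IsTwoShellGood (1 / 20) (47 / 50) 1 x i) := ⟨_, rfl⟩
  obtain ⟨Bc, hBc⟩ : ∃ Bc : Finset (Fin N),
      Bc = Finset.univ.filter (fun j : Fin N => ¬ IsTwoShellGood (1 / 20) (47 / 50) 1 x j ∧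
        ∃ i : Fin N, IsTwoShellGood (1 / 20) (47 / 50) 1 x i ∧ dist (x i) (x j) ≤ 21 / 20) :=
    ⟨_, rfl⟩
  obtain ⟨bd, hbd⟩ : ∃ bd : Finset (Fin N),
      bd = B.filter (fun i => ∃ j : Fin N, j ∉ B ∧ dist (x j) (x i) ≤ R') := ⟨_, rfl⟩
  have hmemB : ∀ i, i ∈ B ↔ ¬ IsTwoShellGood (1 / 20) (47 / 50) 1 x i := fun i => by
    rw [hB]; simp
  have hmemG : ∀ i, i ∈ G ↔ IsTwoShellGood (1 / 20) (47 / 50) 1 x i := fun i => by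
    rw [hG]; simp
  have hmemBc : ∀ j, j ∈ Bc ↔ (¬ IsTwoShellGood (1 / 20) (47 / 50) 1 x j ∧
      ∃ i : Fin N, IsTwoShellGood (1 / 20) (47 / 50) 1 x i ∧ dist (x i) (x j) ≤ 21 / 20) :=
    fun j => by rw [hBc]; simp
  have hmembd : ∀ i, i ∈ bd ↔ (i ∈ B ∧ ∃ j : Fin N, j ∉ B ∧ dist (x j) (x i) ≤ R') := fun i => by
    rw [hbd, Finset.mem_filter]
  have hGc : Gᶜ = B := by
    ext i; rw [Finset.mem_compl, hmemB, hmemG]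
  -- (0) `E − N e* = Σ_B (…) + Σ_G (…)`
  have hsplit : ∑ i ∈ B, (((1 / 2 : ℝ) * ∑ j ∈ Finset.univ.erase i, lennardJones (dist (x i) (x j))) -
        (⨅ Q : PeriodicConfiguration 3, Q.energyPerParticle lennardJones)) +
      ∑ i ∈ G, (((1 / 2 : ℝ) * ∑ j ∈ Finset.univ.erase i, lennardJones (dist (x i) (x j))) -
        (⨅ Q : PeriodicConfiguration 3, Q.energyPerParticle lennardJones)) =
      interactionEnergy lennardJones x -
        (N : ℝ) * (⨅ Q : PeriodicConfiguration 3, Q.energyPerParticle lennardJones) := by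
    have h := sum_halfSite_sub_eStar x
    rw [← Finset.sum_filter_add_sum_filter_not Finset.univ
      (fun i : Fin N => ¬ IsTwoShellGood (1 / 20) (47 / 50) 1 x i)] at h
    have hGeq : Finset.univ.filter (fun i : Fin N => ¬¬ IsTwoShellGood (1 / 20) (47 / 50) 1 x i) = G := by
      rw [hG]; ext i; simp
    rw [hGeq, ← hB] at h
    exact h
  -- (1) far field on `B`, moved to the radius `R'` and the constant `C'' = max C' 0 ≥ 0`
  have hfarB := hAt N x hsep B (fun i hi => (hmemB i).1 hi)
  have hbdR : (Nat.card {i : Fin N // i ∈ B ∧ ∃ j : Fin N, j ∉ B ∧ dist (x j) (x i) ≤ R} : ℝ) ≤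
      (Nat.card {i : Fin N // i ∈ B ∧ ∃ j : Fin N, j ∉ B ∧ dist (x j) (x i) ≤ R'} : ℝ) := by
    have h := Nat.card_le_card_of_injective
      (fun a : {i : Fin N // i ∈ B ∧ ∃ j : Fin N, j ∉ B ∧ dist (x j) (x i) ≤ R} =>
        (⟨a.1, a.2.1, by obtain ⟨j, hj, hd⟩ := a.2.2; exact ⟨j, hj, hd.trans hR'R⟩⟩ :
          {i : Fin N // i ∈ B ∧ ∃ j : Fin N, j ∉ B ∧ dist (x j) (x i) ≤ R'}))
      (fun a b hab => Subtype.ext (by simpa using congrArg Subtype.val hab))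
    exact_mod_cast h
  have hcardbd : (Nat.card {i : Fin N // i ∈ B ∧ ∃ j : Fin N, j ∉ B ∧ dist (x j) (x i) ≤ R'} : ℝ) =
      bd.card := by
    have e : {i : Fin N // i ∈ B ∧ ∃ j : Fin N, j ∉ B ∧ dist (x j) (x i) ≤ R'} ≃ {i : Fin N // i ∈ bd} :=
      Equiv.subtypeEquivRight fun i => (hmembd i).symm
    rw [Nat.card_congr e, Nat.card_eq_fintype_card, Fintype.card_coe]
  have hnn : (0 : ℝ) ≤
      (Nat.card {i : Fin N // i ∈ B ∧ ∃ j : Fin N, j ∉ B ∧ dist (x j) (x i) ≤ R} : ℝ) := by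
    positivity
  have hfarB' : g * (B.card : ℝ) - C'' * (bd.card : ℝ) ≤
      ∑ i ∈ B, (((1 / 2 : ℝ) * ∑ j ∈ Finset.univ.erase i, lennardJones (dist (x i) (x j))) -
        (⨅ Q : PeriodicConfiguration 3, Q.energyPerParticle lennardJones)) := by
    rw [← hcardbd]
    have h1 : C' * (Nat.card {i : Fin N // i ∈ B ∧ ∃ j : Fin N, j ∉ B ∧ dist (x j) (x i) ≤ R} : ℝ) ≤
        C'' * (Nat.card {i : Fin N // i ∈ B ∧ ∃ j : Fin N, j ∉ B ∧ dist (x j) (x i) ≤ R'} : ℝ) :=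
      (mul_le_mul_of_nonneg_right hC''C hnn).trans (mul_le_mul_of_nonneg_left hbdR hC''0)
    linarith only [hfarB, h1]
  -- (2) the good side: restriction + periodisation + cross attraction charged to `B`
  obtain ⟨fG, hfG⟩ : ∃ fG : Fin G.card ↪ Fin N, fG = (G.orderEmbOfFin rfl).toEmbedding := ⟨_, rfl⟩
  have hmapG : Finset.univ.map fG = G := by rw [hfG]; exact Finset.map_orderEmbOfFin_univ G rfl
  have hGsum := sum_halfSite_eq_restrict x G fG hmapG
  obtain ⟨EG, hEG⟩ : ∃ EG : ℝ, EG = interactionEnergy lennardJones (x ∘ fG) := ⟨_, rfl⟩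
  rw [← hEG] at hGsum
  have hyinj : Function.Injective (x ∘ fG) := fun k l hkl => by
    by_contra hne
    have := hsep (fG k) (fG l) (fun h => hne (fG.injective h))
    have h0 : dist (x (fG k)) (x (fG l)) = 0 := dist_eq_zero.2 hkl
    rw [h0] at this
    exact absurd this (not_le.2 hδ)
  have hper : ((G.card : ℕ) : ℝ) * (⨅ Q : PeriodicConfiguration 3, Q.energyPerParticle lennardJones) ≤
      EG := by
    rw [hEG]
    exact card_mul_iInf_le_interactionEnergy hyinj
  have hV : ∀ i j : Fin N, i ≠ j →
      -((1 / 6 : ℝ) * (dist (x i) (x j))⁻¹ ^ 6) ≤ lennardJones (dist (x i) (x j)) := fun i j hij =>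
    neg_le_lennardJones_of_le (lt_of_lt_of_le hδ (hsep i j hij)) le_rfl
  have hcrossj : ∀ j ∈ B, -((1 / 6 : ℝ) * ∑ i ∈ G, (dist (x j) (x i))⁻¹ ^ 6) ≤
      ∑ i ∈ G, lennardJones (dist (x j) (x i)) := fun j hj => by
    rw [Finset.mul_sum, ← Finset.sum_neg_distrib]
    refine Finset.sum_le_sum fun i hi => hV j i ?_
    rintro rfl
    exact (hmemB j).1 hj ((hmemG j).1 hi)
  have hbd_j : ∀ j ∈ B, -(2 * A) ≤ ∑ i ∈ G, lennardJones (dist (x j) (x i)) := fun j hj => by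
    have hsub : G ⊆ Finset.univ.erase j := fun i hi =>
      Finset.mem_erase.2 ⟨fun h => (hmemB j).1 hj ((hmemG j).1 (h ▸ hi)), Finset.mem_univ _⟩
    have hle : ∑ i ∈ G, (dist (x j) (x i))⁻¹ ^ 6 ≤
        ∑ i ∈ Finset.univ.erase j, (dist (x j) (x i))⁻¹ ^ 6 :=
      Finset.sum_le_sum_of_subset_of_nonneg hsub fun i _ _ => by positivity
    have hshell := sum_inv_pow_six_le x hδ hsep j
    have hc := hcrossj j hj
    rw [hA]
    linarith only [hc, hle, hshell]
  have hit_j : ∀ j ∈ B, j ∉ bd → -g ≤ ∑ i ∈ G, lennardJones (dist (x j) (x i)) := fun j hj hjbd => by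
    have hnot : ∀ i : Fin N, i ∉ B → R' < dist (x i) (x j) := by
      intro i hi
      by_contra hle
      exact hjbd ((hmembd j).2 ⟨hj, i, hi, not_lt.1 hle⟩)
    have hS : ∀ i ∈ G, δ * n₀ ≤ dist (x j) (x i) := fun i hi => by
      have hiB : i ∉ B := fun h => (hmemB i).1 h ((hmemG i).1 hi)
      have := hnot i hiB
      rw [dist_comm] at this
      have hc : δ * (n₀ : ℝ) = (n₀ : ℝ) * δ := mul_comm _ _
      linarith only [this, hR'n, hc]
    have htail := sum_inv_pow_six_tail_le x hδ hsep j G hn₀1 hS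
    have hc := hcrossj j hj
    have h3 : (1 / 6 : ℝ) * (250 * δ⁻¹ ^ 6 / n₀) = (125 / 3 : ℝ) * δ⁻¹ ^ 6 / n₀ := by ring
    have h4 : (1 / 6 : ℝ) * ∑ i ∈ G, (dist (x j) (x i))⁻¹ ^ 6 ≤ (1 / 6 : ℝ) * (250 * δ⁻¹ ^ 6 / n₀) :=
      mul_le_mul_of_nonneg_left htail (by norm_num)
    linarith only [hc, h3, h4, htailg]
  have hcross : -(2 * A) * (bd.card : ℝ) - g * (B.card : ℝ) ≤
      ∑ i ∈ G, ∑ j ∈ Gᶜ, lennardJones (dist (x i) (x j)) := by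
    rw [hGc, Finset.sum_comm]
    have hsym : ∀ j ∈ B, ∑ i ∈ G, lennardJones (dist (x i) (x j)) =
        ∑ i ∈ G, lennardJones (dist (x j) (x i)) := fun j _ =>
      Finset.sum_congr rfl fun i _ => by rw [dist_comm]
    rw [Finset.sum_congr rfl hsym]
    have hpt : ∀ j ∈ B, (if j ∈ bd then -(2 * A) else -g) ≤
        ∑ i ∈ G, lennardJones (dist (x j) (x i)) := fun j hj => by
      split_ifs with h
      · exact hbd_j j hj
      · exact hit_j j hj h
    have hsum := Finset.sum_le_sum hpt
    have hite : ∑ j ∈ B, (if j ∈ bd then -(2 * A) else -g) =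
        -(2 * A) * ((B.filter fun j => j ∈ bd).card : ℝ) +
          -g * ((B.filter fun j => ¬ j ∈ bd).card : ℝ) := by
      rw [Finset.sum_ite, Finset.sum_const, Finset.sum_const, nsmul_eq_mul, nsmul_eq_mul]
      ring
    have hf1 : ((B.filter fun j => j ∈ bd).card : ℝ) = bd.card := by
      congr 1
      congr 1
      ext j
      rw [Finset.mem_filter, hmembd]
      tauto
    have hf2 : ((B.filter fun j => ¬ j ∈ bd).card : ℝ) ≤ B.card := by
      exact_mod_cast Finset.card_filter_le _ _
    rw [hite, hf1] at hsum
    exact cross_arith hsum hf2 hg.le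
  have hGside : -A * (bd.card : ℝ) - g / 2 * (B.card : ℝ) ≤
      ∑ i ∈ G, (((1 / 2 : ℝ) * ∑ j ∈ Finset.univ.erase i, lennardJones (dist (x i) (x j))) -
        (⨅ Q : PeriodicConfiguration 3, Q.energyPerParticle lennardJones)) := by
    rw [Finset.sum_sub_distrib, hGsum, Finset.sum_const, nsmul_eq_mul]
    linarith only [hper, hcross]
  -- (3) boundary count: `#bd ≤ K' · #Bc` (nearest good particle, one descent step, fibre)
  have hbd_le : (bd.card : ℝ) ≤ K' * (Bc.card : ℝ) := by
    have hfib : ((bd \ Bc).card : ℝ) ≤ (2 * R' / δ + 1) ^ 3 * (Bc.card : ℝ) := by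
      refine fibre_count hδ hR'0 x hsep (bd \ Bc) Bc fun j hj => ?_
      obtain ⟨hjbd, hjBc⟩ := Finset.mem_sdiff.1 hj
      obtain ⟨hjB, i', hi'B, hi'd⟩ := (hmembd j).1 hjbd
      have hjbad : ¬ IsTwoShellGood (1 / 20) (47 / 50) 1 x j := (hmemB j).1 hjB
      have hi'good : IsTwoShellGood (1 / 20) (47 / 50) 1 x i' := by
        by_contra h; exact hi'B ((hmemB i').2 h)
      have hGne : G.Nonempty := ⟨i', (hmemG i').2 hi'good⟩
      obtain ⟨i₀, hi₀G, hmin⟩ := G.exists_min_image (fun i => dist (x j) (x i)) hGne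
      have hi₀good : IsTwoShellGood (1 / 20) (47 / 50) 1 x i₀ := (hmemG i₀).1 hi₀G
      have hD_le : dist (x j) (x i₀) ≤ R' := by
        have := hmin i' ((hmemG i').2 hi'good)
        rw [dist_comm] at hi'd
        exact this.trans hi'd
      have hD_gt : (21 / 20 : ℝ) < dist (x j) (x i₀) := by
        by_contra hle
        push Not at hle
        exact hjBc ((hmemBc j).2 ⟨hjbad, i₀, hi₀good, by rw [dist_comm]; exact hle⟩)
      have hji₀ : j ≠ i₀ := fun h => hjbad (h ▸ hi₀good)
      obtain ⟨k, -, hkd, hkj⟩ := hdesc N x i₀ j hi₀good hji₀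
      have hkbad : ¬ IsTwoShellGood (1 / 20) (47 / 50) 1 x k := fun hk => by
        have := hmin k ((hmemG k).2 hk)
        linarith
      refine ⟨k, (hmemBc k).2 ⟨hkbad, i₀, hi₀good, ?_⟩, ?_⟩
      · rw [dist_comm]; exact hkd
      · linarith
    have hsd : (bd.card : ℝ) ≤ ((bd \ Bc).card : ℝ) + (Bc.card : ℝ) := by
      exact_mod_cast Finset.card_le_card_sdiff_add_card (s := bd) (t := Bc)
    have hexp : K' * (Bc.card : ℝ) = (2 * R' / δ + 1) ^ 3 * (Bc.card : ℝ) + (Bc.card : ℝ) := by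
      rw [hK']; ring
    linarith only [hfib, hsd, hexp]
  -- (4) tight contact gap, with the counts as finset cardinalities
  have hCGx := hCG N x hsep
  have hcardBc : (Nat.card {j : Fin N // ¬ IsTwoShellGood (1 / 20) (47 / 50) 1 x j ∧
      ∃ i : Fin N, IsTwoShellGood (1 / 20) (47 / 50) 1 x i ∧ dist (x i) (x j) ≤ 21 / 20} : ℝ) =
      Bc.card := by
    have e : {j : Fin N // ¬ IsTwoShellGood (1 / 20) (47 / 50) 1 x j ∧
        ∃ i : Fin N, IsTwoShellGood (1 / 20) (47 / 50) 1 x i ∧ dist (x i) (x j) ≤ 21 / 20} ≃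
        {j : Fin N // j ∈ Bc} :=
      Equiv.subtypeEquivRight fun j => (hmemBc j).symm
    rw [Nat.card_congr e, Nat.card_eq_fintype_card, Fintype.card_coe]
  rw [hcardBc] at hCGx
  have hcardB : (Nat.card {i : Fin N // ¬ IsTwoShellGood (1 / 20) (47 / 50) 1 x i} : ℝ) = B.card := by
    have e : {i : Fin N // ¬ IsTwoShellGood (1 / 20) (47 / 50) 1 x i} ≃ {i : Fin N // i ∈ B} :=
      Equiv.subtypeEquivRight fun i => (hmemB i).symm
    rw [Nat.card_congr e, Nat.card_eq_fintype_card, Fintype.card_coe]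
  rw [hcardB]
  -- (5) assemble: X ≥ (g/2) b − M c and X ≥ g₂ c ⇒ X ≥ g₂ (g/2) b / (g₂ + M)
  have h1 : C'' * (bd.card : ℝ) + A * (bd.card : ℝ) ≤ M * (Bc.card : ℝ) :=
    calc C'' * (bd.card : ℝ) + A * (bd.card : ℝ) = (C'' + A) * (bd.card : ℝ) := by ring
      _ ≤ (C'' + A) * (K' * (Bc.card : ℝ)) := mul_le_mul_of_nonneg_left hbd_le (by linarith)
      _ = M * (Bc.card : ℝ) := by rw [hM]; ring
  have hii : g₂ * (Bc.card : ℝ) ≤ interactionEnergy lennardJones x -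
      (N : ℝ) * (⨅ Q : PeriodicConfiguration 3, Q.energyPerParticle lennardJones) := by
    linarith only [hCGx]
  have hden : 0 < g₂ + M := by positivity
  have hfin := glue_arith hsplit hfarB' hGside h1 hii hg₂.le hM0 hden
  linarith only [hfin]

/-- **Registered stub `stub_glueNearFree` of line `Sketch` (skeleton v5)**: the near-free glue in
the implication form `FarFieldGapR → TightContactGap → CoerciveTwoShellGap` (verbatim signature of the
registered stub; proof = `coerciveTwoShellGap_of_farFieldGapR_of_tightContactGap`). [folklore] -/
theorem stub_glueNearFree :
    FarFieldGapR →
    (∀ δ : ℝ, 0 < δ → ∃ g₂ : ℝ, 0 < g₂ ∧ ∀ (N : ℕ) (x : Fin N → EuclideanSpace ℝ (Fin 3)),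
      (∀ i j : Fin N, i ≠ j → δ ≤ dist (x i) (x j)) →
      (N : ℝ) * (⨅ Q : PeriodicConfiguration 3, Q.energyPerParticle lennardJones)
        + g₂ * (Nat.card {j : Fin N // ¬ IsTwoShellGood (1 / 20) (47 / 50) 1 x j ∧
            ∃ i : Fin N, IsTwoShellGood (1 / 20) (47 / 50) 1 x i ∧ dist (x i) (x j) ≤ 21 / 20} : ℝ)
        ≤ interactionEnergy lennardJones x) →
    CoerciveTwoShellGap :=
  fun hfar hcontact => coerciveTwoShellGap_of_farFieldGapR_of_tightContactGap hfar hcontact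

/-- **The crux as typed IS "the antecedents yield the tight contact gap"**:
`NearFarGlueR ↔ (FarFieldGapR → NearFieldConvexity → TightContactGap)` — under `FarFieldGapR` the
target and the tight contact gap are equivalent (near-free glue one way, monotonicity the other).
Both antecedents are silent on tight contacts (they hold outright on thin sets,
`NearFarGlueRNegative.farField_ineq_of_thin` / `nearField_ineq_of_thin`), which is why the line's
residual `stub_tightContactGap` is crux-sized. [folklore] -/
theorem nearFarGlueR_iff :
    NearFarGlueR ↔ (FarFieldGapR → NearFieldConvexity →
      ∀ δ : ℝ, 0 < δ → ∃ g₂ : ℝ, 0 < g₂ ∧ ∀ (N : ℕ) (x : Fin N → EuclideanSpace ℝ (Fin 3)),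
        (∀ i j : Fin N, i ≠ j → δ ≤ dist (x i) (x j)) →
        (N : ℝ) * (⨅ Q : PeriodicConfiguration 3, Q.energyPerParticle lennardJones)
          + g₂ * (Nat.card {j : Fin N // ¬ IsTwoShellGood (1 / 20) (47 / 50) 1 x j ∧
              ∃ i : Fin N, IsTwoShellGood (1 / 20) (47 / 50) 1 x i ∧ dist (x i) (x j) ≤ 21 / 20} : ℝ)
          ≤ interactionEnergy lennardJones x) := by
  unfold NearFarGlueR
  exact ⟨fun h hF hN => tightContactGap_of_coerciveTwoShellGap (h hF hN),
    fun h hF hN => coerciveTwoShellGap_of_farFieldGapR_of_tightContactGap hF (h hF hN)⟩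

end Summit.AtomisticToContinuum.Crystallization.Theorems.PhononSlackCertificatesNearFarGlueR

end
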